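import Literature.AlgebraicGeometry.Motives.JouanolouTorsor
import Literature.AlgebraicGeometry.Motives.JouanolouTorsorChartRing
import Literature.AlgebraicGeometry.Motives.GeneratingSectionsOfFunctions
import HarnessLib

/-!
# The chart `X' × 𝔸ᴺ ↪ X ×ₖ (ℙᴺ)^*` of Jouanolou's torsor is an open immersion onto `π⁻¹ X'`

Topic `Literature/AlgebraicGeometry/Motives`; definitions + theorems, no named facts. Third file of
the discharge of `jouanolou_affineTorsor` (Jouanolou 1973, Lemme 1.5) through the incidence-complement
model `Y = {(x, a) | Σᵢ aᵢ xᵢ(x) ≠ 0} ⊆ X ×ₖ (ℙᴺ)^*` (`Motives/JouanolouTorsor`,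
`Motives/JouanolouTorsorChartRing`).

For `ι : X ⟶ ℙᴺ_k`, a chart index `j` and an affine open `X' ⊆ ι⁻¹ D₊(x_j)` with `B = Γ(X, X')`, let
`W = Spec B[t₁, …, t_N] = X' × 𝔸ᴺ` (`chartSrc`) and `a = (a₀ : … : a_N)` the moving hyperplane
(`hypVec`, `Σᵢ uᵢ aᵢ = 1`). This file constructs the morphism

  `φ : W ⟶ X ×ₖ (ℙᴺ)^*`,  `(x, t) ↦ (x, [a(x, t)])`   (`toProd`; on underlying schemes `toProdMor`)

— first component `Spec B[t] → Spec B = X' ⊆ X` (`toBase`), second component the morphism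
`W → (ℙᴺ)^*` defined by the functions `aᵢ` without common zero (Hartshorne II Thm. 7.1 for `𝒪_W`,
`Motives/GeneratingSectionsOfFunctions`; `toDualChart`) — and proves:

* `locImm_toProdMor` — **chartwise description**: on `{a_l ≠ 0} = Spec B[t][a_l⁻¹]`, `φ` is `Spec` of the
  chart ring map `ρ_l : B ⊗ₖ (k[a]_{(a_l)})₀ → B[t][a_l⁻¹]` (`JouanolouTorsor.chartHom`) followed by
  the affine chart `X' ×ₖ D₊(a_l) ↪ X ×ₖ (ℙᴺ)^*` (`UniversalHyperplaneSection.chartImm`);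
* `isOpenImmersion_toProdMor` — **`φ` is an open immersion** (open immersions are Zariski-local
  on the target: over the chart `X' ×ₖ D₊(a_l)` it is `Spec` of the localisation `ρ_l` at the
  incidence function `g_l`, `isLocalization_away_chartHom`);
* `range_toProdMor` — **its image is `π⁻¹X' = pr₁⁻¹ X' ∖ {Σᵢ aᵢ xᵢ(x) = 0}`**
  (`preimage_chartImm_incidenceLocus`: on the chart the incidence locus is `{g_l = 0}`).

Consequently `φ` factors through an open immersion `ψ : W ⟶ Y` over `X` (`toTorsor`,
`isOpenImmersion_toTorsor_left`, `toTorsor_proj`) with image exactly `π⁻¹ X'`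
(`range_toTorsor_left`): `π⁻¹ X' ≅ X' × 𝔸ᴺ` compatibly with the projection to `X'`, i.e.
Jouanolou's torsor is, Zariski-locally on `X`, the product with `𝔸ᴺ` (assembled over `ℂ` in
`HodgeTheory/JouanolouDeviceHolds`).

## References

* J.-P. Jouanolou, *Une suite exacte de Mayer–Vietoris en K-théorie algébrique*, LNM 341 (1973),
  Lemme 1.5. [Jouanolou1973]
* R. Hartshorne, *Algebraic Geometry* (1977): II Thm. 7.1 (morphisms to `ℙⁿ`), II Prop. 2.5 (b),
  II Ex. 3.11 / Stacks 01IO (open immersions are local on the target). [Hartshorne1977]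
-/

noncomputable section

open CategoryTheory CategoryTheory.Limits AlgebraicGeometry MonoidalCategory HomogeneousLocalization
  TopologicalSpace
open scoped TensorProduct

universe u

namespace Literature.AlgebraicGeometry.Motives

-- `MvPolynomial.gradedAlgebra` is a `def` in Mathlib (no global instance), cf. `Motives/SegreEmbedding`.
attribute [local instance] MvPolynomial.gradedAlgebra

namespace JouanolouTorsor

open UniversalHyperplaneSection

variable {k : Type u} [Field k] {N : ℕ} {X : SchemeOver k} (ι : X ⟶ projectiveSpace N k)
  (j : Fin (N + 1)) (X' : X.left.affineOpens)
  (hX' : (X' : X.left.Opens) ≤ ι.left ⁻¹ᵁ Proj.basicOpen (Segre.grading (Fin (N + 1)) k) (MvPolynomial.X j))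

attribute [local instance] UniversalHyperplaneSection.chartBaseRingAlgebra
  UniversalHyperplaneSection.sectionsAlgebra

/-! ### The affine scheme `W = X' × 𝔸ᴺ = Spec B[t]` and its two projections -/

variable (N) in
/-- `W = Spec B[t₁, …, t_N] = X' ×ₖ 𝔸ᴺ` as a `k`-scheme. [cite: Jouanolou1973, Lemme 1.5] -/
def chartSrc : SchemeOver k := specOver k (chartSrcRing N X')

variable (N) in
/-- The underlying scheme of `W` is `Spec B[t]` (`rfl`). [cite: Jouanolou1973, Lemme 1.5] -/
theorem chartSrc_left : (chartSrc N X').left = Spec (.of (chartSrcRing N X')) := rfl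

variable (N) in
/-- The structure morphism of `W` is `Spec` of `k → B[t]` (`rfl`). [cite: Jouanolou1973, Lemme 1.5] -/
theorem chartSrc_hom :
    (chartSrc N X').hom = Spec.map (CommRingCat.ofHom (algebraMap k (chartSrcRing N X'))) := rfl

/-- The functions `aᵢ` as global sections of `Spec B[t]`. [cite: Jouanolou1973, Lemme 1.5] -/
def secVec (i : Fin (N + 1)) : Γ(Spec (.of (chartSrcRing N X')), ⊤) :=
  (Scheme.ΓSpecIso (.of (chartSrcRing N X'))).inv (hypVec ι j X' hX' i)

/-- The non-vanishing locus of the section `aᵢ` is the basic open `D(aᵢ)`. [cite: Jouanolou1973, Lemme 1.5] -/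
theorem basicOpen_secVec (i : Fin (N + 1)) :
    (Spec (.of (chartSrcRing N X'))).basicOpen (secVec ι j X' hX' i) =
      PrimeSpectrum.basicOpen (hypVec ι j X' hX' i) :=
  basicOpen_eq_of_affine _

/-- The `D(aᵢ)` cover `Spec B[t]` (the `aᵢ` generate the unit ideal). [cite: Jouanolou1973, Lemme 1.5] -/
theorem iSup_basicOpen_secVec :
    ⨆ i, (Spec (.of (chartSrcRing N X'))).basicOpen (secVec ι j X' hX' i) = ⊤ := by
  have h : ⨆ i, PrimeSpectrum.basicOpen (hypVec ι j X' hX' i) = ⊤ :=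
    PrimeSpectrum.iSup_basicOpen_eq_top_iff.mpr (span_range_hypVec ι j X' hX')
  exact (iSup_congr (basicOpen_secVec ι j X' hX')).trans h

/-- The generating-sections data of the functions `aᵢ` on `Spec B[t]` (Hartshorne II Thm. 7.1 for
`𝒪`). [cite: Hartshorne1977, II Thm. 7.1] -/
abbrev gsData : GeneratingSections (Fin (N + 1)) (Spec (.of (chartSrcRing N X'))) :=
  GeneratingSections.ofFunctions (secVec ι j X' hX') (iSup_basicOpen_secVec ι j X' hX')

/-- **The second component** `W ⟶ (ℙᴺ)^*`, `(x, t) ↦ [a(x, t)]`: the morphism defined by the functions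
`aᵢ` without common zero. [cite: Jouanolou1973, Lemme 1.5] [cite: Hartshorne1977, II Thm. 7.1] -/
def toDualChart : chartSrc N X' ⟶ dualProjectiveSpace N k :=
  GeneratingSections.toProjectiveSpace (Z := chartSrc N X') (gsData ι j X' hX')

/-- Unfolding of `toDualChart`. [cite: Hartshorne1977, II Thm. 7.1] -/
theorem toDualChart_left : (toDualChart ι j X' hX').left = (gsData ι j X' hX').toProj (chartSrc N X').hom := rfl

variable (N) in
/-- **The first component** `W = Spec B[t] ⟶ Spec B = X' ⊆ X`. [cite: Jouanolou1973, Lemme 1.5] -/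
def toBase : chartSrc N X' ⟶ X :=
  Over.homMk (Spec.map (CommRingCat.ofHom
      (algebraMap Γ(X.left, (X' : X.left.Opens)) (chartSrcRing N X'))) ≫ X'.2.fromSpec) (by
    change (Spec.map _ ≫ X'.2.fromSpec) ≫ X.hom =
      Spec.map (CommRingCat.ofHom (algebraMap k (chartSrcRing N X')))
    rw [Category.assoc, fromSpec_comp_hom X'.2, ← Spec.map_comp, ← CommRingCat.ofHom_comp,
      ← algebraMap_sections X (X' : X.left.Opens),
      ← IsScalarTower.algebraMap_eq k Γ(X.left, (X' : X.left.Opens)) (chartSrcRing N X')])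

variable (N) in
/-- Unfolding of `toBase`. [cite: Jouanolou1973, Lemme 1.5] -/
theorem toBase_left :
    (toBase N X').left = Spec.map (CommRingCat.ofHom
      (algebraMap Γ(X.left, (X' : X.left.Opens)) (chartSrcRing N X'))) ≫ X'.2.fromSpec := rfl

/-- **The chart morphism** `φ : W = X' × 𝔸ᴺ ⟶ X ×ₖ (ℙᴺ)^*`, `(x, t) ↦ (x, [a(x, t)])`.
[cite: Jouanolou1973, Lemme 1.5] -/
def toProd : chartSrc N X' ⟶ X ⊗ dualProjectiveSpace N k :=
  CartesianMonoidalCategory.lift (toBase N X') (toDualChart ι j X' hX')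

/-- `φ ≫ pr₁ = toBase`. [cite: Jouanolou1973, Lemme 1.5] -/
theorem toProd_fst : toProd ι j X' hX' ≫ CartesianMonoidalCategory.fst _ _ = toBase N X' :=
  CartesianMonoidalCategory.lift_fst _ _

/-- `φ ≫ pr₂ = toDualChart`. [cite: Jouanolou1973, Lemme 1.5] -/
theorem toProd_snd : toProd ι j X' hX' ≫ CartesianMonoidalCategory.snd _ _ = toDualChart ι j X' hX' :=
  CartesianMonoidalCategory.lift_snd _ _

/-- `φ` on underlying schemes, as a morphism `Spec B[t] ⟶ X.left ×_{Spec k} (ℙᴺ)^*` into Mathlib's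
`pullback` (the underlying scheme of `X ⊗ (ℙᴺ)^*`). [cite: Jouanolou1973, Lemme 1.5] -/
def toProdMor : Spec (.of (chartSrcRing N X')) ⟶ pullback X.hom (dualProjectiveSpace N k).hom :=
  (toProd ι j X' hX').left

/-- `toProdMor` is `toProd` on underlying schemes (`rfl`). [cite: Jouanolou1973, Lemme 1.5] -/
theorem toProdMor_eq : toProdMor ι j X' hX' = (toProd ι j X' hX').left := rfl

/-- `φ ≫ pr₁` on underlying schemes. [cite: Jouanolou1973, Lemme 1.5] -/
theorem toProdMor_fst :
    toProdMor ι j X' hX' ≫ pullback.fst X.hom (dualProjectiveSpace N k).hom = (toBase N X').left :=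
  congrArg CommaMorphism.left (toProd_fst ι j X' hX')

/-- `φ ≫ pr₂` on underlying schemes. [cite: Jouanolou1973, Lemme 1.5] -/
theorem toProdMor_snd :
    toProdMor ι j X' hX' ≫ pullback.snd X.hom (dualProjectiveSpace N k).hom =
      (gsData ι j X' hX').toProj (chartSrc N X').hom :=
  congrArg CommaMorphism.left (toProd_snd ι j X' hX')

/-! ### `φ` on the basic open `{a_l ≠ 0} = Spec B[t][a_l⁻¹]` -/

section Chart

variable (l : Fin (N + 1))

/-- The open immersion `Spec B[t][a_l⁻¹] ⟶ Spec B[t]` onto `{a_l ≠ 0}`. [cite: Jouanolou1973, Lemme 1.5] -/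
def locImm : Spec (.of (locRing ι j X' hX' l)) ⟶ Spec (.of (chartSrcRing N X')) :=
  Spec.map (CommRingCat.ofHom (algebraMap (chartSrcRing N X') (locRing ι j X' hX' l)))

/-- `locImm` is an open immersion (a localisation). [cite: Hartshorne1977, II Prop. 2.5 (b)] -/
instance isOpenImmersion_locImm : IsOpenImmersion (locImm ι j X' hX' l) :=
  IsOpenImmersion.of_isLocalization (hypVec ι j X' hX' l)

/-- The image of `locImm` is `D(a_l)`. [cite: Hartshorne1977, II Prop. 2.5 (b)] -/
theorem range_locImm :
    Set.range (locImm ι j X' hX' l) =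
      (((Spec (.of (chartSrcRing N X'))).basicOpen (secVec ι j X' hX' l) :
        (Spec (.of (chartSrcRing N X'))).Opens) : Set _) := by
  rw [basicOpen_secVec]
  exact PrimeSpectrum.localization_away_comap_range (locRing ι j X' hX' l) (hypVec ι j X' hX' l)

/-- `locImm` lands in `D(a_l)`. [cite: Hartshorne1977, II Prop. 2.5 (b)] -/
theorem top_le_locImm_preimage :
    ⊤ ≤ locImm ι j X' hX' l ⁻¹ᵁ (Spec (.of (chartSrcRing N X'))).basicOpen (secVec ι j X' hX' l) := by
  rintro x -
  change locImm ι j X' hX' l x ∈ (Spec (.of (chartSrcRing N X'))).basicOpen (secVec ι j X' hX' l)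
  rw [← SetLike.mem_coe, ← range_locImm]
  exact ⟨x, rfl⟩

/-- Pulling back the section `aᵢ` along `locImm`: the element `aᵢ ∈ B[t][a_l⁻¹]`.
[cite: Jouanolou1973, Lemme 1.5] -/
theorem locImm_appTop_secVec (i : Fin (N + 1)) :
    (locImm ι j X' hX' l).appTop (secVec ι j X' hX' i) =
      (Scheme.ΓSpecIso (.of (locRing ι j X' hX' l))).inv
        (algebraMap (chartSrcRing N X') (locRing ι j X' hX' l) (hypVec ι j X' hX' i)) := by
  rw [secVec, locImm, ← CommRingCat.comp_apply, ← Scheme.ΓSpecIso_inv_naturality, CommRingCat.comp_apply]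
  rfl

/-- `pull` of a morphism `Spec` of a ring map, elementwise. [cite: Hartshorne1977, II Prop. 2.5 (b)] -/
theorem pull_SpecMap_ofHom {R S : Type u} [CommRing R] [CommRing S] (φ : R →+* S) (r : R) :
    Segre.pull (Spec.map (CommRingCat.ofHom φ)) r = (Scheme.ΓSpecIso (.of S)).inv (φ r) := by
  rw [Segre.pull_apply, ← CommRingCat.comp_apply, ← Scheme.ΓSpecIso_inv_naturality, CommRingCat.comp_apply]
  rfl

/-- **The chart ring map of `toDualChart` over `{a_l ≠ 0}` is `dualChartHom`** (`aᵢ/a_l ↦ aᵢ a_l⁻¹`), up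
to `Γ(Spec B[t][a_l⁻¹], 𝒪) ≅ B[t][a_l⁻¹]`. [cite: Hartshorne1977, II Thm. 7.1 (proof)] -/
theorem chartRingHom_gsData_eq_pull :
    (gsData ι j X' hX').chartRingHom (chartSrc N X').hom l (locImm ι j X' hX' l)
        (top_le_locImm_preimage ι j X' hX' l) =
      Segre.pull (Spec.map (CommRingCat.ofHom (dualChartHom ι j X' hX' l))) := by
  refine Segre.ringHom_ext_away k l ?_ (fun i ↦ ?_)
  · rw [GeneratingSections.chartRingHom_comp_cst]
    have hc : locImm ι j X' hX' l ≫ (chartSrc N X').hom =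
        Spec.map (CommRingCat.ofHom (algebraMap k (locRing ι j X' hX' l))) := by
      rw [locImm, chartSrc_hom, ← Spec.map_comp, ← CommRingCat.ofHom_comp, ← IsScalarTower.algebraMap_eq]
    ext c
    rw [hc, pull_SpecMap_ofHom, RingHom.comp_apply, pull_SpecMap_ofHom, dualChartHom_cst]
  · have hu := GeneratingSections.isUnit_appTop (secVec ι j X' hX') (locImm ι j X' hX' l) l
      (top_le_locImm_preimage ι j X' hX' l)
    rw [← hu.mul_left_inj, GeneratingSections.chartRingHom_ofFunctions_frac_mul,
      pull_SpecMap_ofHom, locImm_appTop_secVec, locImm_appTop_secVec, dualChartHom_frac, ← map_mul,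
      mul_assoc, invHyp_mul_algebraMap_hypVec, mul_one]

/-- `ρ_l` restricted to `(k[a]_{(a_l)})₀` is `dualChartHom`. [cite: Jouanolou1973, Lemme 1.5] -/
theorem chartHom_comp_includeRight :
    (chartHom ι j X' hX' l).comp
        (Algebra.TensorProduct.includeRight (R := k) (A := Γ(X.left, (X' : X.left.Opens)))
          (B := chartBaseRing (k := k) N l)).toRingHom =
      dualChartHom ι j X' hX' l := by
  ext r
  simp [Algebra.TensorProduct.includeRight_apply]

/-- `ρ_l` restricted to `B` is `B → B[t] → B[t][a_l⁻¹]`. [cite: Jouanolou1973, Lemme 1.5] -/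
theorem chartHom_comp_algebraMap :
    (chartHom ι j X' hX' l).comp (algebraMap Γ(X.left, (X' : X.left.Opens)) (chartRing (X := X) l X')) =
      (algebraMap (chartSrcRing N X') (locRing ι j X' hX' l)).comp
        (algebraMap Γ(X.left, (X' : X.left.Opens)) (chartSrcRing N X')) := by
  ext b
  rw [RingHom.comp_apply, RingHom.comp_apply, Algebra.TensorProduct.algebraMap_apply,
    Algebra.algebraMap_self, RingHom.id_apply, chartHom_tmul, map_one, mul_one, MvPolynomial.algebraMap_eq]

/-- **`φ` on `{a_l ≠ 0}` is `Spec ρ_l` followed by the affine chart `X' ×ₖ D₊(a_l) ↪ X ×ₖ (ℙᴺ)^*`.**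
[cite: Jouanolou1973, Lemme 1.5] -/
theorem locImm_toProdMor :
    locImm ι j X' hX' l ≫ (toProdMor ι j X' hX') =
      Spec.map (CommRingCat.ofHom (chartHom ι j X' hX' l)) ≫ chartImm X l X' := by
  apply pullback.hom_ext
  · simp only [Category.assoc]
    rw [toProdMor_fst, toBase_left, chartImm_fst, locImm, ← Spec.map_comp_assoc, ← Spec.map_comp_assoc,
      ← CommRingCat.ofHom_comp, ← CommRingCat.ofHom_comp, chartHom_comp_algebraMap]
  · simp only [Category.assoc]
    rw [toProdMor_snd, chartImm_snd]
    -- (the codomain `(ℙᴺ)^*.left` is only definitionally `Proj _`, so `rw` cannot see the lemma)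
    refine (GeneratingSections.comp_toProj_ofFunctions (secVec ι j X' hX') (iSup_basicOpen_secVec ι j X' hX')
        (chartSrc N X').hom (locImm ι j X' hX' l) (top_le_locImm_preimage ι j X' hX' l)).trans ?_
    change _ = Spec.map (CommRingCat.ofHom (chartHom ι j X' hX' l)) ≫
      Spec.map (CommRingCat.ofHom (RingHomClass.toRingHom
        (Algebra.TensorProduct.includeRight (R := k) (A := Γ(X.left, (X' : X.left.Opens)))
          (B := chartBaseRing (k := k) N l)))) ≫ Segre.chartι k l
    rw [← Spec.map_comp_assoc, ← CommRingCat.ofHom_comp]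
    have h : (chartHom ι j X' hX' l).comp (RingHomClass.toRingHom
        (Algebra.TensorProduct.includeRight (R := k) (A := Γ(X.left, (X' : X.left.Opens)))
          (B := chartBaseRing (k := k) N l))) = dualChartHom ι j X' hX' l :=
      chartHom_comp_includeRight ι j X' hX' l
    rw [h, chartRingHom_gsData_eq_pull, Segre.toSpecΓ_SpecMap_pull_assoc]

/-- `Spec ρ_l : Spec B[t][a_l⁻¹] ⟶ Spec (B ⊗ₖ (k[a]_{(a_l)})₀)` is an open immersion (`ρ_l` is a
localisation, `isLocalization_away_chartHom`). [cite: Jouanolou1973, Lemme 1.5] -/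
instance isOpenImmersion_SpecMap_chartHom :
    IsOpenImmersion (Spec.map (CommRingCat.ofHom (chartHom ι j X' hX' l))) :=
  @IsOpenImmersion.of_isLocalization _ _ _ _ (chartHom ι j X' hX' l).toAlgebra (incidenceFun ι j l X' hX')
    (isLocalization_away_chartHom ι j X' hX' l)

/-- The image of `Spec ρ_l` is `{g_l ≠ 0}`. [cite: Jouanolou1973, Lemme 1.5] -/
theorem range_SpecMap_chartHom :
    Set.range (Spec.map (CommRingCat.ofHom (chartHom ι j X' hX' l))) =
      ((PrimeSpectrum.basicOpen (incidenceFun ι j l X' hX') : Opens (PrimeSpectrum (chartRing (X := X) l X'))) :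
        Set (PrimeSpectrum (chartRing (X := X) l X'))) :=
  @PrimeSpectrum.localization_away_comap_range _ _ (locRing ι j X' hX' l) _ (chartHom ι j X' hX' l).toAlgebra
    (incidenceFun ι j l X' hX') (isLocalization_away_chartHom ι j X' hX' l)

/-- `φ` restricted to `{a_l ≠ 0}` is an open immersion. [cite: Jouanolou1973, Lemme 1.5] -/
theorem isOpenImmersion_locImm_toProdMor :
    IsOpenImmersion (locImm ι j X' hX' l ≫ toProdMor ι j X' hX') := by
  rw [locImm_toProdMor]
  exact IsOpenImmersion.comp _ _

end Chart

/-! ### `φ` is an open immersion onto `pr₁⁻¹ X' ∖ {Σᵢ aᵢ xᵢ = 0}` -/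

variable (N) in
/-- The open `pr₁⁻¹ X' ⊆ X ×ₖ (ℙᴺ)^*`. [cite: Jouanolou1973, Lemme 1.5] -/
def baseOpen : (pullback X.hom (dualProjectiveSpace N k).hom).Opens :=
  pullback.fst X.hom (dualProjectiveSpace N k).hom ⁻¹ᵁ (X' : X.left.Opens)

/-- `φ` lands in `pr₁⁻¹ X'`. [cite: Jouanolou1973, Lemme 1.5] -/
theorem range_toProdMor_subset_baseOpen :
    Set.range (toProdMor ι j X' hX') ⊆ (baseOpen N X' : Set _) := by
  rintro _ ⟨z, rfl⟩
  change pullback.fst X.hom (dualProjectiveSpace N k).hom ((toProdMor ι j X' hX') z) ∈ (X' : X.left.Opens)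
  rw [← Scheme.Hom.comp_apply, toProdMor_fst, toBase_left, Scheme.Hom.comp_apply, ← SetLike.mem_coe,
    ← X'.2.range_fromSpec]
  exact ⟨_, rfl⟩

/-- `φ` as a morphism to the open subscheme `pr₁⁻¹ X'`. [cite: Jouanolou1973, Lemme 1.5] -/
def toBaseOpen : Spec (.of (chartSrcRing N X')) ⟶ (baseOpen N X' : Scheme) :=
  IsOpenImmersion.lift (baseOpen N X').ι (toProdMor ι j X' hX')
    (by rw [Scheme.Opens.range_ι]; exact range_toProdMor_subset_baseOpen ι j X' hX')

/-- `toBaseOpen ≫ (pr₁⁻¹X' ↪ X × (ℙᴺ)^*) = φ`. [cite: Jouanolou1973, Lemme 1.5] -/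
@[reassoc]
theorem toBaseOpen_ι : toBaseOpen ι j X' hX' ≫ (baseOpen N X').ι = (toProdMor ι j X' hX') :=
  IsOpenImmersion.lift_fac _ _ _

variable (N) in
/-- The opens `pr₁⁻¹X' ∩ pr₂⁻¹ D₊(a_l)` of `pr₁⁻¹X'` (the images of the affine charts `X' ×ₖ D₊(a_l)`).
[cite: Jouanolou1973, Lemme 1.5] -/
def coverOpen (l : Fin (N + 1)) : (baseOpen N X' : Scheme).Opens :=
  ((baseOpen N X').ι ≫ pullback.snd X.hom (dualProjectiveSpace N k).hom) ⁻¹ᵁ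
    Proj.basicOpen (Segre.grading (Fin (N + 1)) k) (MvPolynomial.X l)

/-- The `pr₁⁻¹X' ∩ pr₂⁻¹ D₊(a_l)` cover `pr₁⁻¹X'`. [cite: Hartshorne1977, II Prop. 2.5 (b)] -/
theorem iSup_coverOpen : ⨆ l, coverOpen N X' l = ⊤ :=
  ((baseOpen N X').ι ≫ pullback.snd X.hom (dualProjectiveSpace N k).hom).iSup_preimage_eq_top
    (Proj.iSup_basicOpen_eq_top (Segre.grading (Fin (N + 1)) k) (fun l ↦ MvPolynomial.X l)
      (Segre.irrelevant_le_span_X (Fin (N + 1)) k))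

/-- `φ⁻¹ (pr₂⁻¹ D₊(a_l)) = {a_l ≠ 0}`. [cite: Hartshorne1977, II Thm. 7.1] -/
theorem toProdMor_preimage_snd_basicOpen (l : Fin (N + 1)) :
    (toProdMor ι j X' hX') ⁻¹ᵁ (pullback.snd X.hom (dualProjectiveSpace N k).hom ⁻¹ᵁ
        Proj.basicOpen (Segre.grading (Fin (N + 1)) k) (MvPolynomial.X l)) =
      (Spec (.of (chartSrcRing N X'))).basicOpen (secVec ι j X' hX' l) := by
  rw [← Scheme.Hom.comp_preimage, toProdMor_snd]
  exact GeneratingSections.toProj_ofFunctions_preimage_basicOpen (secVec ι j X' hX')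
    (iSup_basicOpen_secVec ι j X' hX') (chartSrc N X').hom l

/-- `toBaseOpen⁻¹ (pr₁⁻¹X' ∩ pr₂⁻¹ D₊(a_l)) = {a_l ≠ 0}`. [cite: Hartshorne1977, II Thm. 7.1] -/
theorem toBaseOpen_preimage_coverOpen (l : Fin (N + 1)) :
    toBaseOpen ι j X' hX' ⁻¹ᵁ coverOpen N X' l =
      (Spec (.of (chartSrcRing N X'))).basicOpen (secVec ι j X' hX' l) := by
  rw [coverOpen, ← Scheme.Hom.comp_preimage, toBaseOpen_ι_assoc, Scheme.Hom.comp_preimage,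
    toProdMor_preimage_snd_basicOpen]

/-- `φ` restricted to the open `{a_l ≠ 0} ⊆ Spec B[t]` is an open immersion.
[cite: Jouanolou1973, Lemme 1.5] -/
theorem isOpenImmersion_basicOpen_ι_toProdMor (l : Fin (N + 1)) :
    IsOpenImmersion (((Spec (.of (chartSrcRing N X'))).basicOpen (secVec ι j X' hX' l)).ι ≫
      (toProdMor ι j X' hX')) := by
  have hr : Set.range ((Spec (.of (chartSrcRing N X'))).basicOpen (secVec ι j X' hX' l)).ι =
      Set.range (locImm ι j X' hX' l) := by
    rw [Scheme.Opens.range_ι, range_locImm]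
  rw [← IsOpenImmersion.isoOfRangeEq_hom_fac _ _ hr, Category.assoc]
  have := isOpenImmersion_locImm_toProdMor ι j X' hX' l
  exact IsOpenImmersion.comp _ _

/-- `toBaseOpen` restricted over `pr₁⁻¹X' ∩ pr₂⁻¹ D₊(a_l)` is an open immersion.
[cite: Jouanolou1973, Lemme 1.5] -/
theorem isOpenImmersion_toBaseOpen_restrict (l : Fin (N + 1)) :
    IsOpenImmersion (toBaseOpen ι j X' hX' ∣_ coverOpen N X' l) := by
  have h2 : IsOpenImmersion (((toBaseOpen ι j X' hX' ⁻¹ᵁ coverOpen N X' l).ι ≫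
      toBaseOpen ι j X' hX') ≫ (baseOpen N X').ι) := by
    rw [Category.assoc, toBaseOpen_ι, toBaseOpen_preimage_coverOpen]
    exact isOpenImmersion_basicOpen_ι_toProdMor ι j X' hX' l
  have h1 : IsOpenImmersion ((toBaseOpen ι j X' hX' ⁻¹ᵁ coverOpen N X' l).ι ≫
      toBaseOpen ι j X' hX') :=
    IsOpenImmersion.of_comp _ (baseOpen N X').ι
  rw [← morphismRestrict_ι] at h1
  exact IsOpenImmersion.of_comp _ (coverOpen N X' l).ι

/-- `toBaseOpen : Spec B[t] ⟶ pr₁⁻¹X'` is an open immersion (open immersions are Zariski-local on the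
target). [cite: Jouanolou1973, Lemme 1.5] -/
instance isOpenImmersion_toBaseOpen : IsOpenImmersion (toBaseOpen ι j X' hX') :=
  IsZariskiLocalAtTarget.of_iSup_eq_top (coverOpen N X') (iSup_coverOpen X')
    (fun l ↦ isOpenImmersion_toBaseOpen_restrict ι j X' hX' l)

/-- **`φ : X' × 𝔸ᴺ ⟶ X ×ₖ (ℙᴺ)^*` is an open immersion.** [cite: Jouanolou1973, Lemme 1.5] -/
instance isOpenImmersion_toProdMor : IsOpenImmersion (toProdMor ι j X' hX') := by
  rw [← toBaseOpen_ι]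
  exact IsOpenImmersion.comp _ _

/-- **The image of `φ` is `π⁻¹ X' = pr₁⁻¹ X' ∖ {Σᵢ aᵢ xᵢ(x) = 0}`.** [cite: Jouanolou1973, Lemme 1.5] -/
theorem range_toProdMor :
    Set.range (toProdMor ι j X' hX') =
      (baseOpen N X' : Set ↥(pullback X.hom (dualProjectiveSpace N k).hom)) ∩
        (incidenceLocus N ι : Set (X ⊗ dualProjectiveSpace N k).left)ᶜ := by
  apply Set.Subset.antisymm
  · rintro _ ⟨z, rfl⟩
    refine ⟨range_toProdMor_subset_baseOpen ι j X' hX' ⟨z, rfl⟩, ?_⟩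
    -- pick a chart `{a_l ≠ 0}` containing `z`
    have hz : z ∈ (⊤ : (Spec (.of (chartSrcRing N X'))).Opens) := trivial
    rw [← iSup_basicOpen_secVec ι j X' hX', Opens.mem_iSup] at hz
    obtain ⟨l, hl⟩ := hz
    rw [← SetLike.mem_coe, ← range_locImm] at hl
    obtain ⟨w, rfl⟩ := hl
    rw [← Scheme.Hom.comp_apply, locImm_toProdMor, Scheme.Hom.comp_apply, Set.mem_compl_iff, ← Set.mem_preimage,
      preimage_chartImm_incidenceLocus ι j l X' hX']
    have hw : Spec.map (CommRingCat.ofHom (chartHom ι j X' hX' l)) w ∈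
        ((PrimeSpectrum.basicOpen (incidenceFun ι j l X' hX') : Opens (PrimeSpectrum (chartRing (X := X) l X'))) :
          Set (PrimeSpectrum (chartRing (X := X) l X'))) := by
      rw [← range_SpecMap_chartHom]
      exact ⟨w, rfl⟩
    rw [PrimeSpectrum.basicOpen_eq_zeroLocus_compl] at hw
    exact hw
  · rintro q ⟨hq, hq'⟩
    -- pick a chart `D₊(a_l)` containing `pr₂ q`
    -- (retype the point `pr₂ q` as a point of `Proj _`, so that the `Opens` membership lemmas apply)
    set q₂ : ↥(Proj (Segre.grading (Fin (N + 1)) k)) := pullback.snd X.hom (dualProjectiveSpace N k).hom q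
      with hq₂
    have hq2 : q₂ ∈ (⊤ : (Proj (Segre.grading (Fin (N + 1)) k)).Opens) := trivial
    rw [← Proj.iSup_basicOpen_eq_top (Segre.grading (Fin (N + 1)) k) (fun l ↦ MvPolynomial.X l)
      (Segre.irrelevant_le_span_X (Fin (N + 1)) k), Opens.mem_iSup] at hq2
    obtain ⟨l, hl⟩ := hq2
    have hqr : q ∈ Set.range (chartImm X l X') := by
      rw [range_chartImm]
      exact ⟨hq, hl⟩
    obtain ⟨y, rfl⟩ := hqr
    have hy : y ∈ ((PrimeSpectrum.basicOpen (incidenceFun ι j l X' hX') :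
        Opens (PrimeSpectrum (chartRing (X := X) l X'))) : Set (PrimeSpectrum (chartRing (X := X) l X'))) := by
      rw [PrimeSpectrum.basicOpen_eq_zeroLocus_compl]
      have hy' : y ∉ chartImm X l X' ⁻¹' (incidenceLocus N ι : Set (X ⊗ dualProjectiveSpace N k).left) := hq'
      rw [preimage_chartImm_incidenceLocus ι j l X' hX'] at hy'
      exact hy'
    rw [← range_SpecMap_chartHom] at hy
    obtain ⟨w, rfl⟩ := hy
    refine ⟨locImm ι j X' hX' l w, ?_⟩
    rw [← Scheme.Hom.comp_apply, locImm_toProdMor, Scheme.Hom.comp_apply]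

/-! ### The chart as an open immersion `ψ : X' × 𝔸ᴺ ⟶ Y` onto `π⁻¹ X'` -/

/-- `φ` lands in `Y ⊆ X ×ₖ (ℙᴺ)^*`: its image misses the incidence locus. [cite: Jouanolou1973, Lemme 1.5] -/
theorem range_toProdMor_subset_range_incl :
    Set.range (toProdMor ι j X' hX') ⊆ Set.range (incl N ι).left := by
  intro z hz
  rw [range_toProdMor] at hz
  -- (`exact`, not `rw`: the carriers `(X ⊗ (ℙᴺ)^*).left` and `pullback _ _` agree only definitionally)
  exact (range_incl_left N ι).symm.subset hz.2

/-- **The chart of Jouanolou's torsor** `ψ : W = X' × 𝔸ᴺ ⟶ Y` over `k`, `(x, t) ↦ (x, [a(x, t)])`: the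
factorisation of `φ` through the open subscheme `Y = {Σᵢ aᵢ xᵢ ≠ 0}`. [cite: Jouanolou1973, Lemme 1.5] -/
def toTorsor : chartSrc N X' ⟶ jouanolouTorsor N ι :=
  Over.homMk (IsOpenImmersion.lift (incl N ι).left (toProdMor ι j X' hX')
      (range_toProdMor_subset_range_incl ι j X' hX'))
    (by
      change IsOpenImmersion.lift (incl N ι).left (toProdMor ι j X' hX')
          (range_toProdMor_subset_range_incl ι j X' hX') ≫ (incl N ι).left ≫
            (X ⊗ dualProjectiveSpace N k).hom = (chartSrc N X').hom
      rw [IsOpenImmersion.lift_fac_assoc]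
      exact Over.w (toProd ι j X' hX'))

/-- `ψ ≫ (Y ↪ X ×ₖ (ℙᴺ)^*) = φ` on underlying schemes. [cite: Jouanolou1973, Lemme 1.5] -/
@[reassoc]
theorem toTorsor_left_comp_incl_left :
    (toTorsor ι j X' hX').left ≫ (incl N ι).left = toProdMor ι j X' hX' :=
  IsOpenImmersion.lift_fac _ _ _

/-- `ψ ≫ (Y ↪ X ×ₖ (ℙᴺ)^*) = φ`. [cite: Jouanolou1973, Lemme 1.5] -/
theorem toTorsor_incl : toTorsor ι j X' hX' ≫ incl N ι = toProd ι j X' hX' :=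
  Over.OverMorphism.ext (toTorsor_left_comp_incl_left ι j X' hX')

/-- **`ψ` is a morphism over `X`**: `ψ ≫ π = (W = X' × 𝔸ᴺ → X' ⊆ X)`. [cite: Jouanolou1973, Lemme 1.5] -/
theorem toTorsor_proj : toTorsor ι j X' hX' ≫ proj N ι = toBase N X' := by
  rw [proj, ← Category.assoc, toTorsor_incl, toProd_fst]

/-- **`ψ` is an open immersion.** [cite: Jouanolou1973, Lemme 1.5] -/
instance isOpenImmersion_toTorsor_left : IsOpenImmersion (toTorsor ι j X' hX').left := by
  have h : IsOpenImmersion ((toTorsor ι j X' hX').left ≫ (incl N ι).left) := by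
    rw [toTorsor_left_comp_incl_left]
    exact isOpenImmersion_toProdMor ι j X' hX'
  exact IsOpenImmersion.of_comp _ (incl N ι).left

/-- **The image of `ψ` is `π⁻¹ X'`**: every point of `Y` over `X'` is in the image of the chart (and
conversely, `toTorsor_proj`). [cite: Jouanolou1973, Lemme 1.5] -/
theorem preimage_proj_subset_range_toTorsor :
    (proj N ι).left ⁻¹' ((X' : X.left.Opens) : Set X.left) ⊆ Set.range (toTorsor ι j X' hX').left := by
  intro y hy
  have h1 : (incl N ι).left y ∈ Set.range (toProdMor ι j X' hX') := by
    rw [range_toProdMor]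
    -- (both memberships hold definitionally: `proj = incl ≫ pr₁`, `range incl = 𝒳ᶜ`)
    exact ⟨hy, (range_incl_left N ι).subset ⟨y, rfl⟩⟩
  obtain ⟨w, hw⟩ := h1
  refine ⟨w, (incl N ι).left.isOpenEmbedding.injective ?_⟩
  rw [← Scheme.Hom.comp_apply, toTorsor_left_comp_incl_left]
  exact hw

/-- The image of `ψ` is exactly `π⁻¹ X'`. [cite: Jouanolou1973, Lemme 1.5] -/
theorem range_toTorsor_left :
    Set.range (toTorsor ι j X' hX').left = (proj N ι).left ⁻¹' ((X' : X.left.Opens) : Set X.left) := by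
  refine Set.Subset.antisymm ?_ (preimage_proj_subset_range_toTorsor ι j X' hX')
  rintro _ ⟨w, rfl⟩
  have h : ((toTorsor ι j X' hX').left ≫ (proj N ι).left) w ∈ ((X' : X.left.Opens) : Set X.left) := by
    rw [← Over.comp_left, toTorsor_proj, toBase_left]
    exact (X'.2.range_fromSpec).subset
      ⟨Spec.map (CommRingCat.ofHom (algebraMap _ (chartSrcRing N X'))) w, rfl⟩
  exact h

end JouanolouTorsor

end Literature.AlgebraicGeometry.Motives

end
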